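import Summits.Ventures.HSemireg.WedgeHankelRecurrenceHankelEuclidSignature
import Summits.Ventures.HSemireg.WedgeHankelRecurrenceHankelLeadingZeros
import Summits.Ventures.HSemireg.WedgeHankelRecurrenceHankelInversePair

/-!
# Venture HSemireg — DETERMINANTS ALONG BPR LEMMA 9.24 (any field): the leading principal minors of a Hankel form with `c'` leading zeros VANISH up to order `c'`, the `(c'+1)`-st is anti-triangular
# `= sign(rev_{c'+1}) · s_{c'}^{c'+1}`, and beyond, one Euclidean ∕ inversion step: **`det H_t(Q/P) = sign(rev_{c'+1}) · C_{c'+1}^{c'+1} · det H_d(−R/Q)`** (`P`, `Q` monic, `P = CQ + R`,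
# `t + 1 = (c'+1) + (d+1)`; Euclidean `C`: `= sign(rev_{c'+1}) · det H_d(−(P mod Q)/Q)`), and for an arbitrary sequence with an inverse pair `X^{2t+2} ∣ wy − 1`:
# **`det H_t(X^{c'} w) = sign(rev_{c'+1}) · w_0^{2(t+1)} · y_0^{c'+1} · det H_d(−y_{·+c'+2})`** — the determinant shadow of the congruences N164 ∕ N168 (the mechanism behind Frobenius' rule for the
# signs of Hankel minors and, with N157, behind the Euclidean recursion of subresultants)

HONEST FRAMING. Part of the Lean index of the computation cell `pub-hsemireg` (seat p10 gen 37, Sunday typer «UNIFORM-IN-n»).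
LINEAR ALGEBRA OF HANKEL ∕ BEZOUTIAN MATRICES OVER A FIELD ONLY (`Matrix.det`, `Matrix.rank`; PROVED Literature `Bezoutian` through N164 ∕ N167): no variety, no cohomology theory, no sheaf, no Ext
group and no semiregularity map is constructed here; nothing here says that HC / HC_CM / HC_AV holds; no Literature fact (unproved `Prop`) is declared or used.  Custodian versions as in
`WedgeHankelSiegelIdeal` (1/3).
SOURCE OF THE ARGUMENT (cited; held text read, `book:basu2006-algorithms-real-algebraic-geometry` pp. 337–340): S. Basu, R. Pollack, M.-F. Roy, *Algorithms in Real Algebraic Geometry* (2006)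
§9.2.2 Lemma 9.24 (the congruence, typed in N164 ∕ N168) read at the level of determinants and leading principal minors («`han(s̄_{[0..n]}) = 1, han(s̄_1), …, han(s̄_n)`», Prop. 9.25 ∕ Lemma
9.26 ∕ Remark 9.27 c): the signs of these minors determine the signature of an invertible Hankel form); F. G. Frobenius, *Über das Trägheitsgesetz der quadratischen Formen*, S.-B. Preuss.
Akad. Wiss. (1894) 241–256, 407–431 (BPR ref. [61]) for the rule these identities feed (NOT typed here).
DEDUP DISCLOSURE (`rg` of the whole tree + Mathlib, 2026-09-01): N73 ∕ N141 ∕ N151 compute `det H_e(a/m)` at the FULL size (norm ∕ resultant), N157 identifies leading Hankel minors with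
subresultants, N145 has the anti-triangular determinant; nothing in the tree relates `det H_t(Q/P)` for `t + 1 < deg P` to `det H_d(−R/Q)`, or the minors of a sequence with leading zeros to
those of the tail of its inverse pair — that is this file.  11 names: 0 hits tree-wide.

WHAT IS IN THE TREE (or staged ahead of this file).  N164: **`hankelSq_dualSeq_eq_transpose_fromRows_mul_fromBlocks_mul`**, `dualSeq_eq_zero_and_eq_one_of_monic`, `dualSeq_divByMonic_X_pow_eq_zero_of_lt ∕ _eq_one`;
N165 `divByMonic_modByMonic_data`; N166 `rank_hankelSq_eq_rank_corner`, `hankelSq_eq_zero_of_forall_lt`; N167 `det`-free ingredients; N168 **`hankelSq_coeff_X_pow_mul_eq_transpose_fromRows_mul_fromBlocks_mul`**,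
`transpose_submatrix_mul_submatrix_mul_submatrix`, `coeff_zero_mul_coeff_zero_of_X_pow_dvd`; N145 `det_of_antitriangular`, `rank_hankelSq_of_eq_zero_of_lt`, `hankelSq_submatrix_revPerm`; N147
`bezoutian_one_left_antitriangular`.  Mathlib: `Matrix.det_mul`, `det_transpose`, `det_submatrix_equiv_self`, `det_fromBlocks_zero₂₁`, `det_of_upperTriangular`, `rank_of_isUnit`, `rank_le_width`, `det_zero`,
`Int.units_mul_self`.
THIS FILE (namespace `Summit.Ventures.HSemireg.Wedge.HankelOuter` continued; CHAINED on N165 + N166 + N168; 0 definitions):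
* §809 `submatrix_transpose_mul_mul`, `det_eq_zero_of_rank_lt` (bookkeeping), **`det_hankelSq_eq_zero_of_leading_zeros`** (`det H_k(q) = 0` for `k < z` leading zeros), **`det_hankelSq_of_leading_zeros_self`**
  (`det H_z(q) = sign(rev) q_z^{z+1}`), `det_bezoutian_one_left_of_natDegree_le` (`det B(1,C) = sign(rev) C_c^c`).
* §810 `det_fromRows_dualSeq_submatrix` (N164's basis change has determinant `sign(rev_{c'+1})`), `cast_sign_mul_cast_sign`, **`det_hankelSq_dualSeq_eq_of_eq_mul_add`** (`det H_t(Q/P) = sign(rev_{c'+1})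
  C_{c'+1}^{c'+1} det H_d(−R/Q)`), **`det_hankelSq_dualSeq_eq_sign_mul_det_modByMonic`** (Euclidean instance), **`det_hankelSq_dualSeq_of_lt_and_self`** (the leading minors of `H(Q/P)` up to order
  `c' + 1`).
* §811 `det_of_coeff_X_pow_mul` (`det A_w = w_0^n`), `det_hankelSq_ite_coeff_sub` (head block `= sign(rev) y_0^{c'+1}`), **`det_hankelSq_coeff_X_pow_mul`** (`det H_t(X^{c'} w) = sign(rev_{c'+1})
  w_0^{2(t+1)} y_0^{c'+1} det H_d(−y_{·+c'+2})`).
CAVEATS.  `P`, `Q` monic in §810; §811 needs the inverse pair as a hypothesis; the PmV ∕ Frobenius bookkeeping that turns these minor identities into the signature (BPR Prop. 9.25, Notation 4.30)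
is NOT typed (no `PmV` in the tree).  Nothing Ext-side.  New names only.
-/

open Module Polynomial
open scoped Matrix Polynomial

namespace Summit.Ventures.HSemireg.Wedge.HankelOuter

open Summit.Ventures.HSemireg.Wedge Summit.Ventures.HSemireg.Wedge.Hankel
open Literature.LinearAlgebra.Matrix.Bezoutian (bezoutian bezoutian_apply bezoutian_one_left_apply)

section Det

variable {K : Type*} [Field K]

/-! ## §809. Determinants through a congruence by a stacked basis change; vanishing and anti-triangular leading minors -/

/-- Re-indexing a congruence by a rectangular matrix along a map of the outer index: `(Fᵀ D F).submatrix e e = (F.submatrix id e)ᵀ · D · F.submatrix id e`. [bookkeeping] -/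
theorem submatrix_transpose_mul_mul {m n o : Type*} [Fintype m] (F : Matrix m n K) (D : Matrix m m K) (e : o → n) :
    (Fᵀ * D * F).submatrix e e = (F.submatrix id e)ᵀ * D * F.submatrix id e := by
  ext a b
  simp only [Matrix.submatrix_apply, Matrix.mul_apply, Matrix.transpose_apply, id]

/-- A square matrix over a field whose rank is less than its size has determinant `0`. [bookkeeping] -/
theorem det_eq_zero_of_rank_lt {n : Type*} [Fintype n] [DecidableEq n] {A : Matrix n n K} (h : A.rank < Fintype.card n) : A.det = 0 := by
  by_contra hdet
  have := Matrix.rank_of_isUnit A ((Matrix.isUnit_iff_isUnit_det A).2 (isUnit_iff_ne_zero.2 hdet))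
  omega

/-- **Leading minors inside the zero block vanish: `det H_k(q) = 0` whenever `q_n = 0` for `n < z` and `k < z`** (either `H_k(q) = 0`, or it is a zero-bordered corner of rank `2k + 1 − z ≤ k`, N166).
[this file, §809] -/
theorem det_hankelSq_eq_zero_of_leading_zeros {k z : ℕ} (hkz : k < z) (q : ℕ → K) (hq : ∀ n, n < z → q n = 0) : (hankelSq K k q).det = 0 := by
  rcases lt_or_ge (2 * k) z with h | h
  · rw [hankelSq_eq_zero_of_forall_lt q fun n hn => hq n (by omega), Matrix.det_zero]
  · refine det_eq_zero_of_rank_lt ?_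
    rw [rank_hankelSq_eq_rank_corner (r := 2 * k - z) (by omega) hkz.le q hq, Fintype.card_fin]
    exact lt_of_le_of_lt (Matrix.rank_le_width _) (by omega)

/-- **The first non-vanishing leading minor is anti-triangular: `det H_z(q) = sign(reversal) · q_z^{z+1}`** for `q_n = 0` (`n < z`) — N145's `rank_hankelSq_of_eq_zero_of_lt` through the reversal.
[this file, §809] -/
theorem det_hankelSq_of_leading_zeros_self {z : ℕ} (q : ℕ → K) (hq : ∀ n, n < z → q n = 0) (hqz : q z ≠ 0) :
    (hankelSq K z q).det = Equiv.Perm.sign (Fin.revPerm : Equiv.Perm (Fin (z + 1))) * q z ^ (z + 1) := by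
  rw [← Matrix.det_submatrix_equiv_self (Fin.revPerm : Equiv.Perm (Fin (z + 1))), hankelSq_submatrix_revPerm]
  have h := (rank_hankelSq_of_eq_zero_of_lt z (fun n => q (2 * z - n)) (fun n hn hn2 => hq _ (by omega)) (by simp only [show 2 * z - z = z by omega]; exact hqz)).1
  simp only [show 2 * z - z = z by omega] at h
  exact h

/-- **`det B(1, C) = sign(reversal) · C_c^c`** for `deg C ≤ c` (`B(1,C) = (C_{k+l+1})` is anti-triangular with anti-diagonal `C_c`; N145 `det_of_antitriangular`, N147). [this file, §809] -/
theorem det_bezoutian_one_left_of_natDegree_le {c : ℕ} {C : K[X]} (hC : C.natDegree ≤ c) : (bezoutian c 1 C).det = Equiv.Perm.sign (Fin.revPerm : Equiv.Perm (Fin c)) * C.coeff c ^ c := by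
  obtain ⟨hz, hd⟩ := bezoutian_one_left_antitriangular (K := K) hC
  rw [det_of_antitriangular _ hz, Finset.prod_eq_pow_card (b := C.coeff c) fun k _ => hd k (Fin.rev k) (by rw [Fin.val_rev]; omega), Finset.card_univ, Fintype.card_fin]

/-! ## §810. BPR Lemma 9.24 for `Q/P`, determinant form: `det H_t(Q/P) = sign(rev_{c'+1}) · C_{c'+1}^{c'+1} · det H_d(−R/Q)`, and the leading principal minors of `H(Q/P)` -/

/-- **The stacked basis change `[M₁; M₂]` of N164 has `det² = 1`**: re-indexed along any `E : Fin (c'+1) ⊕ Fin (d+1) ≃ Fin (t+1)` with `E(inl k) = k`, `E(inr k) = c'+1+k` it is `[[H_{c'}(s), ∗], [0, U]]`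
with `U` unipotent and `det H_{c'}(s) = sign(reversal)` (`s_m = 0` for `m < c'`, `s_{c'} = 1`). [this file, §810] -/
theorem det_fromRows_dualSeq_submatrix {e t c' d q' : ℕ} (he : e = c' + q' + 1) (ht : t = c' + d + 1) (hdq : d ≤ q') {P Q : K[X]} (hP : P.Monic) (hPd : P.natDegree = e + 1) (hQ : Q.Monic)
    (hQd : Q.natDegree = q' + 1) (E : Fin (c' + 1) ⊕ Fin (d + 1) ≃ Fin (t + 1)) (hE1 : ∀ k, ((E (Sum.inl k) : Fin (t + 1)) : ℕ) = k) (hE2 : ∀ k, ((E (Sum.inr k) : Fin (t + 1)) : ℕ) = c' + 1 + k) :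
    ((Matrix.fromRows (Matrix.of fun (k : Fin (c' + 1)) (i : Fin (t + 1)) => dualSeq K P Q ((k : ℕ) + i))
        (Matrix.of fun (k : Fin (d + 1)) (i : Fin (t + 1)) => dualSeq K P (Q /ₘ Polynomial.X ^ ((k : ℕ) + 1)) (i : ℕ))).submatrix id E).det
      = Equiv.Perm.sign (Fin.revPerm : Equiv.Perm (Fin (c' + 1))) := by
  obtain ⟨hz, h1⟩ := dualSeq_eq_zero_and_eq_one_of_monic (K := K) he hP hPd hQ hQd
  have hN : (Matrix.fromRows (Matrix.of fun (k : Fin (c' + 1)) (i : Fin (t + 1)) => dualSeq K P Q ((k : ℕ) + i))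
        (Matrix.of fun (k : Fin (d + 1)) (i : Fin (t + 1)) => dualSeq K P (Q /ₘ Polynomial.X ^ ((k : ℕ) + 1)) (i : ℕ))).submatrix id E
      = Matrix.fromBlocks (hankelSq K c' (dualSeq K P Q)) (Matrix.of fun (k : Fin (c' + 1)) (i : Fin (d + 1)) => dualSeq K P Q ((k : ℕ) + (c' + 1 + i)))
          0 (Matrix.of fun (k i : Fin (d + 1)) => dualSeq K P (Q /ₘ Polynomial.X ^ ((k : ℕ) + 1)) (c' + 1 + i)) := by
    ext (k | k) (i | i)
    · rw [Matrix.submatrix_apply, id, Matrix.fromRows_apply_inl, Matrix.of_apply, hE1, Matrix.fromBlocks_apply₁₁, hankelSq, Matrix.of_apply]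
    · rw [Matrix.submatrix_apply, id, Matrix.fromRows_apply_inl, Matrix.of_apply, hE2, Matrix.fromBlocks_apply₁₂, Matrix.of_apply]
    · rw [Matrix.submatrix_apply, id, Matrix.fromRows_apply_inr, Matrix.of_apply, hE1, Matrix.fromBlocks_apply₂₁, Matrix.zero_apply]
      exact dualSeq_divByMonic_X_pow_eq_zero_of_lt he hP hPd hQd (by have := i.isLt; omega) (by have := i.isLt; omega)
    · rw [Matrix.submatrix_apply, id, Matrix.fromRows_apply_inr, Matrix.of_apply, hE2, Matrix.fromBlocks_apply₂₂, Matrix.of_apply]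
  have hU : (Matrix.of fun (k i : Fin (d + 1)) => dualSeq K P (Q /ₘ Polynomial.X ^ ((k : ℕ) + 1)) (c' + 1 + i)).BlockTriangular id := fun k i hik => by
    rw [Matrix.of_apply]
    exact dualSeq_divByMonic_X_pow_eq_zero_of_lt he hP hPd hQd (by have := Fin.lt_def.1 hik; simp only [id] at this; omega) (by have := i.isLt; omega)
  have hdetU : (Matrix.of fun (k i : Fin (d + 1)) => dualSeq K P (Q /ₘ Polynomial.X ^ ((k : ℕ) + 1)) (c' + 1 + i)).det = 1 := by
    rw [Matrix.det_of_upperTriangular hU]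
    exact Finset.prod_eq_one fun k _ => by rw [Matrix.of_apply]; exact dualSeq_divByMonic_X_pow_eq_one he hP hPd hQ hQd (by have := k.isLt; omega)
  rw [hN, Matrix.det_fromBlocks_zero₂₁, hdetU, mul_one, det_hankelSq_of_leading_zeros_self _ hz (by rw [h1]; exact one_ne_zero), h1, one_pow, mul_one]

/-- `sign(σ)² = 1` in `K`. [bookkeeping] -/
theorem cast_sign_mul_cast_sign {n : ℕ} (σ : Equiv.Perm (Fin n)) : ((Equiv.Perm.sign σ : ℤ) : K) * ((Equiv.Perm.sign σ : ℤ) : K) = 1 := by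
  rw [← Int.cast_mul, ← Units.val_mul, Int.units_mul_self, Units.val_one, Int.cast_one]

/-- **BPR LEMMA 9.24 FOR `Q/P`, DETERMINANT FORM (any field): `det H_t(Q/P) = det B(1, C) · det H_d(−R/Q) = sign(rev_{c'+1}) · C_{c'+1}^{c'+1} · det H_d(−R/Q)`** for `P`, `Q` monic of degrees
`(c'+1) + (q'+1)`, `q' + 1`, `P = C Q + R` (`deg C ≤ c' + 1`, `deg R ≤ q' + 1`), `t + 1 = (c'+1) + (d+1)`, `d ≤ q'` (N164's congruence has a basis change of determinant `±1`). [this file, §810] -/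
theorem det_hankelSq_dualSeq_eq_of_eq_mul_add {e t c' d q' : ℕ} (he : e = c' + q' + 1) (ht : t = c' + d + 1) (hdq : d ≤ q') {P Q C R : K[X]} (hP : P.Monic) (hPd : P.natDegree = e + 1)
    (hQ : Q.Monic) (hQd : Q.natDegree = q' + 1) (hdiv : P = C * Q + R) (hC : C.natDegree ≤ c' + 1) (hR : R.natDegree ≤ q' + 1) :
    (hankelSq K t (dualSeq K P Q)).det = Equiv.Perm.sign (Fin.revPerm : Equiv.Perm (Fin (c' + 1))) * C.coeff (c' + 1) ^ (c' + 1) * (hankelSq K d (dualSeq K Q (-R))).det := by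
  obtain ⟨E, hE1, hE2⟩ : ∃ E : Fin (c' + 1) ⊕ Fin (d + 1) ≃ Fin (t + 1), (∀ k, ((E (Sum.inl k) : Fin (t + 1)) : ℕ) = k) ∧ ∀ k, ((E (Sum.inr k) : Fin (t + 1)) : ℕ) = c' + 1 + k :=
    ⟨finSumFinEquiv.trans (finCongr (by omega)), fun k => by simp, fun k => by simp⟩
  have hs := cast_sign_mul_cast_sign (K := K) (Fin.revPerm : Equiv.Perm (Fin (c' + 1)))
  rw [← Matrix.det_submatrix_equiv_self E, hankelSq_dualSeq_eq_transpose_fromRows_mul_fromBlocks_mul he ht hdq hP hPd hQ hQd hdiv hC hR, submatrix_transpose_mul_mul, Matrix.det_mul,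
    Matrix.det_mul, Matrix.det_transpose, det_fromRows_dualSeq_submatrix he ht hdq hP hPd hQ hQd E hE1 hE2, Matrix.det_fromBlocks_zero₂₁, det_bezoutian_one_left_of_natDegree_le hC]
  linear_combination (((Equiv.Perm.sign (Fin.revPerm : Equiv.Perm (Fin (c' + 1))) : ℤ) : K) * C.coeff (c' + 1) ^ (c' + 1) * (hankelSq K d (dualSeq K Q (-R))).det) * hs

/-- **… Euclidean instance: `det H_t(Q/P) = sign(rev_{c'+1}) · det H_d(−(P mod Q)/Q)`** (`P`, `Q` monic; the quotient is monic of degree `c' + 1`). [this file, §810] -/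
theorem det_hankelSq_dualSeq_eq_sign_mul_det_modByMonic {e t c' d q' : ℕ} (he : e = c' + q' + 1) (ht : t = c' + d + 1) (hdq : d ≤ q') {P Q : K[X]} (hP : P.Monic) (hPd : P.natDegree = e + 1)
    (hQ : Q.Monic) (hQd : Q.natDegree = q' + 1) :
    (hankelSq K t (dualSeq K P Q)).det = Equiv.Perm.sign (Fin.revPerm : Equiv.Perm (Fin (c' + 1))) * (hankelSq K d (dualSeq K Q (-(P %ₘ Q)))).det := by
  obtain ⟨hdiv, hC, hCc, hR⟩ := divByMonic_modByMonic_data (K := K) he hP hPd hQ hQd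
  rw [det_hankelSq_dualSeq_eq_of_eq_mul_add he ht hdq hP hPd hQ hQd hdiv hC hR, hCc, one_pow, mul_one]

/-- **THE LEADING PRINCIPAL MINORS OF `H(Q/P)` (`P`, `Q` monic, `deg P − deg Q = c' + 1`): `det H_k(Q/P) = 0` for `k < c'`, `det H_{c'}(Q/P) = sign(rev_{c'+1})`**, and for `k = c' + 1 + j`,
`j + 1 ≤ deg Q`, `det H_k(Q/P) = sign(rev_{c'+1}) · det H_j(−(P mod Q)/Q)` (previous theorem) — BPR's gap of `c'` vanishing Hankel minors followed by the Euclidean recursion (cf. Lemma 9.26: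
these minors are the signed subresultants). [this file, §810] -/
theorem det_hankelSq_dualSeq_of_lt_and_self {e c' q' : ℕ} (he : e = c' + q' + 1) {P Q : K[X]} (hP : P.Monic) (hPd : P.natDegree = e + 1) (hQ : Q.Monic) (hQd : Q.natDegree = q' + 1) :
    (∀ k, k < c' → (hankelSq K k (dualSeq K P Q)).det = 0) ∧ (hankelSq K c' (dualSeq K P Q)).det = Equiv.Perm.sign (Fin.revPerm : Equiv.Perm (Fin (c' + 1))) := by
  obtain ⟨hz, h1⟩ := dualSeq_eq_zero_and_eq_one_of_monic (K := K) he hP hPd hQ hQd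
  exact ⟨fun k hk => det_hankelSq_eq_zero_of_leading_zeros hk _ hz, by rw [det_hankelSq_of_leading_zeros_self _ hz (by rw [h1]; exact one_ne_zero), h1, one_pow, mul_one]⟩

/-! ## §811. BPR Lemma 9.24 for an arbitrary sequence, determinant form: `det H_t(X^{c'} w) = sign(rev_{c'+1}) · w_0^{2(t+1)} · y_0^{c'+1} · det H_d(−y_{·+c'+2})` -/

/-- **`det A_w = w_0^n`**: the Toeplitz matrix `((X^k w)_i)_{k,i<n}` of multiplication by `w` is upper triangular with constant diagonal `w_0`. [this file, §811] -/
theorem det_of_coeff_X_pow_mul (n : ℕ) (w : K[X]) : (Matrix.of fun (k i : Fin n) => (Polynomial.X ^ (k : ℕ) * w).coeff (i : ℕ)).det = w.coeff 0 ^ n := by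
  have hAt : (Matrix.of fun (k i : Fin n) => (Polynomial.X ^ (k : ℕ) * w).coeff (i : ℕ)).BlockTriangular id := fun k i hik => by
    rw [Matrix.of_apply, Polynomial.coeff_X_pow_mul']; exact if_neg (by have := Fin.lt_def.1 hik; simp only [id] at this; omega)
  rw [Matrix.det_of_upperTriangular hAt, Finset.prod_eq_pow_card (b := w.coeff 0) fun k _ => by rw [Matrix.of_apply, Polynomial.coeff_X_pow_mul', if_pos le_rfl, Nat.sub_self],
    Finset.card_univ, Fintype.card_fin]

/-- **The head block: `det H_{c'}(0, …, 0, y_0, …, y_{c'}) = sign(rev_{c'+1}) · y_0^{c'+1}`.** [this file, §811] -/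
theorem det_hankelSq_ite_coeff_sub (c' : ℕ) (y : K[X]) :
    (hankelSq K c' fun m => if c' ≤ m then y.coeff (m - c') else 0).det = Equiv.Perm.sign (Fin.revPerm : Equiv.Perm (Fin (c' + 1))) * y.coeff 0 ^ (c' + 1) := by
  rw [← Matrix.det_submatrix_equiv_self (Fin.revPerm : Equiv.Perm (Fin (c' + 1))), hankelSq_submatrix_revPerm,
    det_of_antitriangular _ (fun i j h => by simp only [hankelSq, Matrix.of_apply]; exact if_neg (by omega)),
    Finset.prod_eq_pow_card (b := y.coeff 0) fun i _ => by simp only [hankelSq, Matrix.of_apply, Fin.val_rev, show 2 * c' - ((i : ℕ) + (c' + 1 - ((i : ℕ) + 1))) = c' by omega, le_refl, if_true, Nat.sub_self],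
    Finset.card_univ, Fintype.card_fin]

/-- **BPR LEMMA 9.24 FOR AN ARBITRARY SEQUENCE, DETERMINANT FORM: `det H_t(X^{c'} w) = sign(rev_{c'+1}) · w_0^{2(t+1)} · y_0^{c'+1} · det H_d(−y_{·+c'+2})`** for an inverse pair
`X^{2t+2} ∣ w·y − 1` and `t + 1 = (c'+1) + (d+1)` (N168's Toeplitz conjugation: `det A_w = w_0^{t+1}`, head block `sign · y_0^{c'+1}`). [this file, §811] -/
theorem det_hankelSq_coeff_X_pow_mul {t c' d : ℕ} (ht : t = c' + d + 1) {w y : K[X]} (hwy : Polynomial.X ^ (2 * t + 2) ∣ w * y - 1) :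
    (hankelSq K t fun n => (Polynomial.X ^ c' * w).coeff n).det
      = Equiv.Perm.sign (Fin.revPerm : Equiv.Perm (Fin (c' + 1))) * w.coeff 0 ^ (2 * (t + 1)) * y.coeff 0 ^ (c' + 1) * (hankelSq K d fun m => -y.coeff (m + c' + 2)).det := by
  obtain ⟨E, hE1, hE2⟩ : ∃ E : Fin (c' + 1) ⊕ Fin (d + 1) ≃ Fin (t + 1), (∀ k, ((E (Sum.inl k) : Fin (t + 1)) : ℕ) = k) ∧ ∀ k, ((E (Sum.inr k) : Fin (t + 1)) : ℕ) = c' + 1 + k :=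
    ⟨finSumFinEquiv.trans (finCongr (by omega)), fun k => by simp, fun k => by simp⟩
  have hA : Matrix.fromRows (Matrix.of fun (k : Fin (c' + 1)) (i : Fin (t + 1)) => (Polynomial.X ^ (k : ℕ) * w).coeff (i : ℕ))
      (Matrix.of fun (k : Fin (d + 1)) (i : Fin (t + 1)) => (Polynomial.X ^ (c' + 1 + k) * w).coeff (i : ℕ))
      = (Matrix.of fun (k i : Fin (t + 1)) => (Polynomial.X ^ (k : ℕ) * w).coeff (i : ℕ)).submatrix E id := by
    ext (k | k) i
    · rw [Matrix.fromRows_apply_inl, Matrix.of_apply, Matrix.submatrix_apply, Matrix.of_apply, hE1, id]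
    · rw [Matrix.fromRows_apply_inr, Matrix.of_apply, Matrix.submatrix_apply, Matrix.of_apply, hE2, id]
  have hD : Matrix.fromBlocks (hankelSq K c' fun m => if c' ≤ m then y.coeff (m - c') else 0) 0 0 (hankelSq K d fun m => -y.coeff (m + c' + 2))
      = ((Matrix.fromBlocks (hankelSq K c' fun m => if c' ≤ m then y.coeff (m - c') else 0) 0 0 (hankelSq K d fun m => -y.coeff (m + c' + 2))).submatrix E.symm E.symm).submatrix E E := by
    rw [Matrix.submatrix_submatrix, Equiv.symm_comp_self, Matrix.submatrix_id_id]
  rw [hankelSq_coeff_X_pow_mul_eq_transpose_fromRows_mul_fromBlocks_mul K ht hwy, hA, hD, transpose_submatrix_mul_submatrix_mul_submatrix, Matrix.det_mul, Matrix.det_mul, Matrix.det_transpose,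
    Matrix.det_submatrix_equiv_self, Matrix.det_fromBlocks_zero₂₁, det_of_coeff_X_pow_mul, det_hankelSq_ite_coeff_sub]
  ring

end Det

end Summit.Ventures.HSemireg.Wedge.HankelOuter
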